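import Summits.MatrixMultiplication.OmegaCensus.DominoZ17StructSixArrB0
import HarnessLib

/-!
# The pair checks of family `B` for the structural part-`6` route, `p = 17` (part 2 of 13; independent of the other parts)

ω-census `pub-omega`, family (b3), seat pub-omega-group gen 25.  Framing: lottery ticket; floor = certified bounds/negative
ranges.  VALUE: per-prime kernel data of the structural part-`6` route WITHOUT the pigeonhole (`DominoZpZpStructSixWide*.lean`)
for `p = 17` — target: the OPEN census cell `(1,6,16)@289` (`A = ℤ₁₇²`) and every larger order with such a quotient; NOT progress on ω.

Per-`x`-arrangement kernel decides `checkH6x 17 etZ17s6 ysbZ17s6 xs` (one `x`-arrangement against the whole `y`-list of family `B`).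
Assembly (`arr6P` literals, per-representative theorems, `checkH6b_17` = hypothesis `h3b` of `exists_goodS_wide`):
`DominoZ17StructSixPairsB.lean`.  Exact pre-check (`code/s6w_checkab.py`): every pinned configuration has ≥ 3 good collapses.
-/

namespace Summit.MatrixMultiplication.OmegaCensus

open ZpZpDomino

namespace ZpZpDomino

set_option maxRecDepth 100000 in
set_option maxHeartbeats 4000000 in
/-- Pair check, family `B`, representative 1, `x`-arrangement 2 against all 1648 `y`-arrangements. [folklore] -/
theorem checkH6bx_17_1_2 : checkH6x 17 etZ17s6 ysbZ17s6 [15,15,14,14,13,14] = true := by decide +kernel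

set_option maxRecDepth 100000 in
set_option maxHeartbeats 4000000 in
/-- Pair check, family `B`, representative 1, `x`-arrangement 3 against all 1648 `y`-arrangements. [folklore] -/
theorem checkH6bx_17_1_3 : checkH6x 17 etZ17s6 ysbZ17s6 [15,15,14,14,14,13] = true := by decide +kernel

set_option maxRecDepth 100000 in
set_option maxHeartbeats 4000000 in
/-- Pair check, family `B`, representative 2, `x`-arrangement 0 against all 1648 `y`-arrangements. [folklore] -/
theorem checkH6bx_17_2_0 : checkH6x 17 etZ17s6 ysbZ17s6 [13,13,14,14,15,16] = true := by decide +kernel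

set_option maxRecDepth 100000 in
set_option maxHeartbeats 4000000 in
/-- Pair check, family `B`, representative 2, `x`-arrangement 1 against all 1648 `y`-arrangements. [folklore] -/
theorem checkH6bx_17_2_1 : checkH6x 17 etZ17s6 ysbZ17s6 [13,13,14,14,16,15] = true := by decide +kernel

set_option maxRecDepth 100000 in
set_option maxHeartbeats 4000000 in
/-- Pair check, family `B`, representative 2, `x`-arrangement 2 against all 1648 `y`-arrangements. [folklore] -/
theorem checkH6bx_17_2_2 : checkH6x 17 etZ17s6 ysbZ17s6 [14,14,13,13,15,16] = true := by decide +kernel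

set_option maxRecDepth 100000 in
set_option maxHeartbeats 4000000 in
/-- Pair check, family `B`, representative 2, `x`-arrangement 3 against all 1648 `y`-arrangements. [folklore] -/
theorem checkH6bx_17_2_3 : checkH6x 17 etZ17s6 ysbZ17s6 [14,14,13,13,16,15] = true := by decide +kernel

end ZpZpDomino

end Summit.MatrixMultiplication.OmegaCensus
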